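import Mathlib.Analysis.SpecialFunctions.Pow.Complex
import Mathlib.Analysis.SpecialFunctions.Pow.Real
import Mathlib.Analysis.SpecialFunctions.Pow.Continuity
import Mathlib.Analysis.SpecialFunctions.Complex.Log
import Mathlib.Topology.Algebra.Module.Cardinality
import Mathlib.Data.Nat.Prime.Basic
import HarnessLib

/-!
# Rigidity of finite Euler products with a functional equation (Deligne–Serre 1974, Lemma 4.9)

Deligne–Serre, *Formes modulaires de poids 1*, Ann. Sci. ÉNS (4) 7 (1974), Lemma 4.9
(p. 515–516) is the elementary analytic lemma that concludes the proof of their Thm. 4.6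
(the Artin conductor of the Galois representation attached to a weight-one newform of level
`N` is `N`, and `L(s, ρ) = Σ a_n n^{-s}`): comparing the functional equations of `Λ_f` and of
the Artin L-function leaves a *finite* Euler product `F(s) = A^s ∏_{p ∣ N} F_p(s)` with a
functional equation `F(1 - s) = ω F̃(s)`, and the lemma says such a product is trivial.

**Lemma 4.9.**  Let `G(s) = A^s ∏_p G_p(s)` and `H(s) = A^s ∏_p H_p(s)` be two finite Euler
products.  Suppose (4.9.1) `G(1 - s) = ω H(s)` with `ω ∈ ℂ*`, and (4.9.2) each `G_p` and each
`H_p` is a finite product of terms `(1 - α_p^{(i)} p^{-s})^{±1}` with `|α_p^{(i)}| < p^{1/2}`.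
Then `A = 1` and `G_p = H_p = 1` for all `p`.

This file states the lemma as the named fact `Literature.NumberTheory.LFunctions.ModularForms.DeligneSerre1974.lemma49` and
**proves** it (`lemma49_holds`); it is a leaf of the decomposition of
`Literature.NumberTheory.Automorphic.artinConductorNat_eq_level` (fact-owner's NOTES; top layer in
`Literature.NumberTheory.Automorphic.LanglandsTunnellProofs`).

## Main definitions

* `Literature.eulerTerm p α s = 1 - α p^{-s}` (principal complex power `(p : ℂ) ^ (-s)`), its
  explicit zeros `Literature.eulerTermZero p α k = -(log α⁻¹ + 2πik)/log p`.
* `Literature.NumberTheory.LFunctions.EulerFactorData`: a local factor `G_p = ∏_{α ∈ num} (1 - α p^{-s}) / ∏_{β ∈ den} (1 - β p^{-s})`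
  recorded by its two finite multisets of roots (roots may vanish — Deligne–Serre allow
  `b_p, c_p = 0` — and may repeat); `numFun`, `denFun`, the reduced datum `reduce`
  (common roots cancelled) and the common part `common`/`commonFun`.
* `Literature.finiteEulerNum S G`, `Literature.finiteEulerDen S G`: numerator and denominator of the finite
  Euler product `∏_{p ∈ S} G_p(s)`.
* `Literature.NumberTheory.LFunctions.ModularForms.DeligneSerre1974.lemma49` (named fact) and `lemma49_holds` (its proof).

## Formalisation of the statement

Numerators and denominators are kept apart, so that no quotient of meromorphic functions
(with junk values at poles) enters: (4.9.1), an identity of meromorphic functions, is stated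
in the equivalent cross-multiplied form
`A^{1-s} N_G(1-s) D_H(s) = ω A^s N_H(s) D_G(1-s)` for **all** `s ∈ ℂ` (both sides are entire,
and two entire functions that agree off a discrete set agree everywhere), and the conclusion
`G_p = 1` as the identity of entire functions `N_{G,p} = D_{G,p}` (numerator equals
denominator; this is exactly `G_p = 1` as a meromorphic function and, unlike equality of the
multisets of roots, is insensitive to vanishing roots).  `A` is a positive real number, as in
the application (`A = (N/M)^{1/2}`).

## Proof (`lemma49_holds`), following op. cit. p. 516

* Zeros of `1 - α p^{-s}` (`α ≠ 0`) are the `s_k = -(log α⁻¹ + 2πik)/log p`, `k ∈ ℤ`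
  (`exists_eq_eulerTermZero_of_eulerTerm_eq_zero`, `eulerTerm_eulerTermZero`): infinitely
  many, with `re s_k = log|α|/log p < 1/2` when `|α| < p^{1/2}` (`re_lt_of_eulerTerm_eq_zero`);
  hence zeros of `N_G(1 - s)`, `D_G(1 - s)` have `re s > 1/2` and zeros of `N_H(s)`, `D_H(s)`
  have `re s < 1/2` ("l'hypothèse `|α| < p^{1/2}` assure qu'aucun des `α` ne peut être égal
  à un `p/α'`").
* For distinct primes `p ≠ q`, `1 - α p^{-s}` and `1 - β q^{-s}` have at most one common
  zero (`subsingleton_setOf_eulerTerm_eq_zero_and`): two of them would give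
  `(k' - k) log q = (j' - j) log p` with `k' ≠ k`, i.e. `q^{|k'-k|} = p^{|j'-j|}`,
  contradicting unique factorisation.
* Core (`lemma49_core`, data with no root common to `num_p(H)` and `den_p(H)`): if some root
  `α ∈ num_p(H)` were nonzero, at each of the infinitely many zeros `s` of `1 - α p^{-s}` the
  right-hand side vanishes, so `D_H(s) = 0` (the other left-hand factors have no zero with
  `re s < 1/2`), i.e. `s` is a zero of some `1 - β q^{-s}`, `β ∈ den_q(H)`; `q = p` forces
  `β = α`, excluded, and `q ≠ p` gives at most one `s` per `(q, β)` (`lemma49_key`) —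
  contradiction.  Symmetrically for `den_p(H)`, and, after `s ↦ 1 - s` (`lemma49_symm`),
  for `G`.
* Reduction (`lemma49_reduce`): cancelling the common roots multiplies both sides by the same
  entire factor `C_G(1-s) C_H(s)`, nonzero off a countable set; continuity and density of the
  complement of a countable subset of `ℂ` (`Set.Countable.dense_compl`) give the identity for
  the reduced data.  So all reduced roots vanish, `N_{G,p} = C_p = D_{G,p}`, and the identity
  collapses to `A^{1-s} = ω A^s`: `s = 1/2` gives `ω = 1`, `s = 0` gives `A = 1`.

## Mathlib search

Mathlib (this pin) has `Complex.cpow`, `Complex.exp_eq_exp_iff_exists_int`, `LSeries`,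
`EulerProduct` (infinite Euler products of Dirichlet series), but no finite Euler products as
objects nor any rigidity statement of this kind (grep `EulerProduct`, `eulerProduct`,
`functional_equation`); nothing here duplicates a Mathlib declaration.

## References

* P. Deligne, J.-P. Serre, *Formes modulaires de poids 1*, Ann. Sci. ÉNS (4) 7 (1974),
  507–530, doi:10.24033/asens.1277 — Lemma 4.9 and its proof, pp. 515–516
  (`DeligneSerreASENS1974`).
-/

noncomputable section

open Complex

namespace Literature.NumberTheory.LFunctions

/-! ### Euler terms `1 - α p^{-s}` and their zeros -/

/-- The **Euler term** `1 - α p^{-s}` (`p^{-s}` is Mathlib's principal complex power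
`(p : ℂ) ^ (-s) = exp (-s log p)`), the building block of the local factors
`(1 - α p^{-s})^{±1}` of an Euler product.  For `α = 0` it is the constant `1`.
Ref: Deligne–Serre 1974, (4.9.2). [folklore] -/
def eulerTerm (p : ℕ) (α : ℂ) (s : ℂ) : ℂ :=
  1 - α * (p : ℂ) ^ (-s)

/-- Unfolding lemma for `eulerTerm`. [folklore] -/
theorem eulerTerm_def (p : ℕ) (α s : ℂ) : eulerTerm p α s = 1 - α * (p : ℂ) ^ (-s) := rfl

/-- `1 - 0 · p^{-s} = 1`. [folklore] -/
@[simp] theorem eulerTerm_zero (p : ℕ) (s : ℂ) : eulerTerm p 0 s = 1 := by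
  simp [eulerTerm]

/-- `1 - α p^{-s} = 0` iff `α p^{-s} = 1`. [folklore] -/
theorem eulerTerm_eq_zero_iff {p : ℕ} {α s : ℂ} :
    eulerTerm p α s = 0 ↔ α * (p : ℂ) ^ (-s) = 1 := by
  rw [eulerTerm, sub_eq_zero, eq_comm]

/-- A zero of `1 - α p^{-s}` forces `α ≠ 0`. [folklore] -/
theorem ne_zero_of_eulerTerm_eq_zero {p : ℕ} {α s : ℂ} (h : eulerTerm p α s = 0) : α ≠ 0 := by
  rintro rfl
  simp at h

/-- The Euler term is continuous in `s` (for `p ≠ 0`). [folklore] -/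
theorem continuous_eulerTerm {p : ℕ} (hp : p ≠ 0) (α : ℂ) : Continuous (eulerTerm p α) :=
  continuous_const.sub (continuous_const.mul
    (continuous_neg.const_cpow (Or.inl (Nat.cast_ne_zero.mpr hp))))

/-- At a zero of `1 - α p^{-s}` one has `|α| = p^{re s}`. [folklore] -/
theorem norm_eq_rpow_of_eulerTerm_eq_zero {p : ℕ} (hp : 0 < p) {α s : ℂ}
    (h : eulerTerm p α s = 0) : ‖α‖ = (p : ℝ) ^ s.re := by
  rw [eulerTerm_eq_zero_iff] at h
  have h1 : ‖α‖ * (p : ℝ) ^ (-s.re) = 1 := by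
    have := congrArg norm h
    rwa [norm_mul, norm_natCast_cpow_of_pos hp, neg_re, norm_one] at this
  have hp' : (0 : ℝ) < p := Nat.cast_pos.mpr hp
  calc ‖α‖ = ‖α‖ * (p : ℝ) ^ (-s.re) * (p : ℝ) ^ s.re := by
        rw [mul_assoc, ← Real.rpow_add hp', neg_add_cancel, Real.rpow_zero, mul_one]
    _ = (p : ℝ) ^ s.re := by rw [h1, one_mul]

/-- **Location of the zeros.**  If `|α| < p^{1/2}` (`p > 1`), every zero of `1 - α p^{-s}` has
`re s < 1/2`.  Ref: Deligne–Serre 1974, proof of Lemma 4.9 ("l'hypothèse `|α| < p^{1/2}`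
assure qu'aucun des `α` ne peut être égal à un `p / α'`"). [folklore] -/
theorem re_lt_of_eulerTerm_eq_zero {p : ℕ} (hp : 1 < p) {α s : ℂ} (hα : ‖α‖ < Real.sqrt p)
    (h : eulerTerm p α s = 0) : s.re < 1 / 2 := by
  have hp' : (1 : ℝ) < p := Nat.one_lt_cast.mpr hp
  rw [norm_eq_rpow_of_eulerTerm_eq_zero (lt_trans zero_lt_one hp) h, Real.sqrt_eq_rpow] at hα
  exact (Real.rpow_lt_rpow_left_iff hp').mp hα

/-- Two Euler terms at the same prime with a common zero have the same root:
`α p^{-s} = 1 = β p^{-s}` forces `α = β`. [folklore] -/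
theorem eq_of_eulerTerm_eq_zero {p : ℕ} {α β s : ℂ} (hα : eulerTerm p α s = 0)
    (hβ : eulerTerm p β s = 0) : α = β := by
  rw [eulerTerm_eq_zero_iff] at hα hβ
  have hps : (p : ℂ) ^ (-s) ≠ 0 := by
    rintro h0
    rw [h0, mul_zero] at hα
    exact zero_ne_one hα
  exact mul_right_cancel₀ hps (hα.trans hβ.symm)

/-! ### The zero set of an Euler term: countable, and infinite for `α ≠ 0` -/

/-- The zeros `s_k = -(log α⁻¹ + 2πik) / log p`, `k ∈ ℤ`, of `1 - α p^{-s}` (`α ≠ 0`, `p > 1`).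
[folklore] -/
def eulerTermZero (p : ℕ) (α : ℂ) (k : ℤ) : ℂ :=
  -(log α⁻¹ + k * (2 * Real.pi * I)) / (Real.log p : ℂ)

/-- `p^{-s} = exp (-s log p)` for a natural number `p ≠ 0`. [folklore] -/
theorem natCast_cpow_neg_eq_exp {p : ℕ} (hp : p ≠ 0) (s : ℂ) :
    (p : ℂ) ^ (-s) = exp ((Real.log p : ℂ) * (-s)) := by
  rw [cpow_def_of_ne_zero (Nat.cast_ne_zero.mpr hp), Complex.natCast_log]

/-- Each `s_k` is a zero of `1 - α p^{-s}`. [folklore] -/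
theorem eulerTerm_eulerTermZero {p : ℕ} (hp : 1 < p) {α : ℂ} (hα : α ≠ 0) (k : ℤ) :
    eulerTerm p α (eulerTermZero p α k) = 0 := by
  have hlog : (Real.log p : ℂ) ≠ 0 :=
    ofReal_ne_zero.mpr (Real.log_ne_zero_of_pos_of_ne_one (by exact_mod_cast lt_trans zero_lt_one hp)
      (by exact_mod_cast hp.ne'))
  rw [eulerTerm_eq_zero_iff, natCast_cpow_neg_eq_exp (ne_zero_of_lt hp), eulerTermZero, neg_div,
    neg_neg, mul_div_cancel₀ _ hlog, exp_add, exp_log (inv_ne_zero hα), exp_int_mul_two_pi_mul_I,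
    mul_one, mul_inv_cancel₀ hα]

/-- The map `k ↦ s_k` is injective. [folklore] -/
theorem eulerTermZero_injective {p : ℕ} (hp : 1 < p) (α : ℂ) :
    Function.Injective (eulerTermZero p α) := by
  have hlog : (Real.log p : ℂ) ≠ 0 :=
    ofReal_ne_zero.mpr (Real.log_ne_zero_of_pos_of_ne_one (by exact_mod_cast lt_trans zero_lt_one hp)
      (by exact_mod_cast hp.ne'))
  have h2pi : (2 * Real.pi * I : ℂ) ≠ 0 := by simp [Real.pi_ne_zero, I_ne_zero]
  intro k l hkl
  rw [eulerTermZero, eulerTermZero, div_left_inj' hlog, neg_inj, add_right_inj,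
    mul_left_inj' h2pi] at hkl
  exact_mod_cast hkl

/-- Every zero of `1 - α p^{-s}` is one of the `s_k`. [folklore] -/
theorem exists_eq_eulerTermZero_of_eulerTerm_eq_zero {p : ℕ} (hp : 1 < p) {α s : ℂ}
    (h : eulerTerm p α s = 0) : ∃ k : ℤ, s = eulerTermZero p α k := by
  have hα := ne_zero_of_eulerTerm_eq_zero h
  have hlog : (Real.log p : ℂ) ≠ 0 :=
    ofReal_ne_zero.mpr (Real.log_ne_zero_of_pos_of_ne_one (by exact_mod_cast lt_trans zero_lt_one hp)
      (by exact_mod_cast hp.ne'))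
  rw [eulerTerm_eq_zero_iff, natCast_cpow_neg_eq_exp (ne_zero_of_lt hp)] at h
  have h' : exp ((Real.log p : ℂ) * (-s)) = exp (log α⁻¹) := by
    rw [exp_log (inv_ne_zero hα)]
    exact eq_inv_of_mul_eq_one_right h
  obtain ⟨k, hk⟩ := exp_eq_exp_iff_exists_int.mp h'
  refine ⟨k, ?_⟩
  rw [eulerTermZero, eq_div_iff hlog, ← hk]
  ring

/-- The zero set of an Euler term is countable. [folklore] -/
theorem countable_setOf_eulerTerm_eq_zero {p : ℕ} (hp : 1 < p) (α : ℂ) :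
    {s | eulerTerm p α s = 0}.Countable :=
  (Set.countable_range (eulerTermZero p α)).mono fun s hs => by
    obtain ⟨k, hk⟩ := exists_eq_eulerTermZero_of_eulerTerm_eq_zero hp hs
    exact ⟨k, hk.symm⟩

/-- For `α ≠ 0` the zero set of `1 - α p^{-s}` is infinite ("la fonction `H` a une infinité de
zéros (ou de pôles) de la forme `(log α + 2πin)/log p`", Deligne–Serre 1974, proof of
Lemma 4.9). [folklore] -/
theorem infinite_setOf_eulerTerm_eq_zero {p : ℕ} (hp : 1 < p) {α : ℂ} (hα : α ≠ 0) :
    {s | eulerTerm p α s = 0}.Infinite :=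
  (Set.infinite_range_of_injective (eulerTermZero_injective hp α)).mono fun s hs => by
    obtain ⟨k, hk⟩ := hs
    rw [Set.mem_setOf_eq, ← hk]
    exact eulerTerm_eulerTermZero hp hα k


/-! ### Zeros common to Euler terms at two distinct primes -/

/-- If `m log p = n log q` for natural numbers `p, q ≥ 1` and integers `m, n`, then
`p^{|m|} = q^{|n|}`. [folklore] -/
theorem pow_natAbs_eq_of_int_mul_log_eq {p q : ℕ} (hp : 0 < p) (hq : 0 < q) {m n : ℤ}
    (h : (m : ℝ) * Real.log p = (n : ℝ) * Real.log q) : p ^ m.natAbs = q ^ n.natAbs := by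
  have hp' : (0 : ℝ) < p := Nat.cast_pos.mpr hp
  have hq' : (0 : ℝ) < q := Nat.cast_pos.mpr hq
  have habs : (m.natAbs : ℝ) * Real.log p = (n.natAbs : ℝ) * Real.log q := by
    have := congrArg abs h
    rwa [abs_mul, abs_mul, abs_of_nonneg (Real.log_nonneg (by exact_mod_cast hp)),
      abs_of_nonneg (Real.log_nonneg (by exact_mod_cast hq)), ← Int.cast_abs, ← Int.cast_abs,
      ← Nat.cast_natAbs, ← Nat.cast_natAbs] at this
  have hlog : Real.log ((p : ℝ) ^ m.natAbs) = Real.log ((q : ℝ) ^ n.natAbs) := by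
    rw [Real.log_pow, Real.log_pow, habs]
  have hR : (p : ℝ) ^ m.natAbs = (q : ℝ) ^ n.natAbs :=
    Real.log_injOn_pos (Set.mem_Ioi.mpr (pow_pos hp' _)) (Set.mem_Ioi.mpr (pow_pos hq' _)) hlog
  exact_mod_cast hR

/-- **Two distinct primes.**  For primes `p ≠ q` the Euler terms `1 - α p^{-s}` and
`1 - β q^{-s}` have at most one common zero: two common zeros `s, s'` would give
`(s - s') log p ∈ 2πiℤ` and `(s - s') log q ∈ 2πiℤ`, whence `p^m = q^n` with `m ≠ 0`,
contradicting unique factorisation ("on voit facilement que ceux-ci ne peuvent pas être tous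
des zéros (ou des pôles) de `G(1 - s)`", Deligne–Serre 1974, proof of Lemma 4.9). [folklore] -/
theorem subsingleton_setOf_eulerTerm_eq_zero_and {p q : ℕ} (hp : p.Prime) (hq : q.Prime)
    (hpq : p ≠ q) (α β : ℂ) :
    {s | eulerTerm p α s = 0 ∧ eulerTerm q β s = 0}.Subsingleton := by
  intro s hs s' hs'
  by_contra hne
  obtain ⟨k, hk⟩ := exists_eq_eulerTermZero_of_eulerTerm_eq_zero hp.one_lt hs.1
  obtain ⟨k', hk'⟩ := exists_eq_eulerTermZero_of_eulerTerm_eq_zero hp.one_lt hs'.1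
  obtain ⟨j, hj⟩ := exists_eq_eulerTermZero_of_eulerTerm_eq_zero hq.one_lt hs.2
  obtain ⟨j', hj'⟩ := exists_eq_eulerTermZero_of_eulerTerm_eq_zero hq.one_lt hs'.2
  have hlogp : (Real.log p : ℂ) ≠ 0 :=
    ofReal_ne_zero.mpr (Real.log_ne_zero_of_pos_of_ne_one (by exact_mod_cast hp.pos)
      (by exact_mod_cast hp.one_lt.ne'))
  have hlogq : (Real.log q : ℂ) ≠ 0 :=
    ofReal_ne_zero.mpr (Real.log_ne_zero_of_pos_of_ne_one (by exact_mod_cast hq.pos)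
      (by exact_mod_cast hq.one_lt.ne'))
  have h2pi : (2 * Real.pi * I : ℂ) ≠ 0 := by simp [Real.pi_ne_zero, I_ne_zero]
  -- `(s - s') log p = (k' - k) 2πi` and `(s - s') log q = (j' - j) 2πi`
  have hP : (s - s') * (Real.log p : ℂ) = ((k' : ℂ) - k) * (2 * Real.pi * I) := by
    rw [hk, hk', eulerTermZero, eulerTermZero]
    field_simp
    ring
  have hQ : (s - s') * (Real.log q : ℂ) = ((j' : ℂ) - j) * (2 * Real.pi * I) := by
    nth_rewrite 1 [hj, hj']
    rw [eulerTermZero, eulerTermZero]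
    field_simp
    ring
  have hkk : (k' : ℂ) - k ≠ 0 := by
    intro h0
    rw [h0, zero_mul, mul_eq_zero, sub_eq_zero] at hP
    exact hne (hP.resolve_right hlogp)
  -- `(k' - k) log q = (j' - j) log p`
  have hcross : ((k' : ℂ) - k) * (Real.log q : ℂ) = ((j' : ℂ) - j) * (Real.log p : ℂ) := by
    have := congrArg₂ (· * ·) hP (Eq.refl (Real.log q : ℂ))
    rw [mul_right_comm, hQ] at this
    -- this : ((j' - j) * 2πi) * log p = ((k' - k) * 2πi) * log q
    have := this.symm
    rw [mul_right_comm, mul_right_comm ((j' : ℂ) - j)] at this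
    exact mul_right_cancel₀ h2pi this
  have hreal : ((k' - k : ℤ) : ℝ) * Real.log q = ((j' - j : ℤ) : ℝ) * Real.log p := by
    apply Complex.ofReal_injective
    simp only [Complex.ofReal_mul, Int.cast_sub, Complex.ofReal_sub, Complex.ofReal_intCast]
    exact hcross
  have hpow := pow_natAbs_eq_of_int_mul_log_eq hq.pos hp.pos hreal
  -- `q ^ |k' - k| = p ^ |j' - j|` with `k' - k ≠ 0`: then `q ∣ p`, so `q = p`.
  have hk0 : (k' - k).natAbs ≠ 0 := by
    rw [ne_eq, Int.natAbs_eq_zero, sub_eq_zero]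
    rintro rfl
    exact hkk (sub_self _)
  have hdvd : q ∣ p ^ (j' - j).natAbs := hpow ▸ dvd_pow_self q hk0
  exact hpq ((Nat.prime_dvd_prime_iff_eq hq hp).mp (hq.dvd_of_dvd_pow hdvd)).symm


/-! ### Local factor data and finite Euler products -/

/-- A **local factor datum** at a prime `p`: the finite multisets of "roots" `α` of the numerator
and of the denominator of a local factor
`G_p(s) = ∏_{α ∈ num} (1 - α p^{-s}) / ∏_{β ∈ den} (1 - β p^{-s})`, i.e. a finite product of
terms `(1 - α p^{-s})^{±1}` as in Deligne–Serre 1974, (4.9.2) (roots may vanish and may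
repeat).  Numerator and denominator are kept apart (`numFun`, `denFun`) so that no division of
meromorphic functions is needed. [cite: DeligneSerreASENS1974, Lemma 4.9] -/
structure EulerFactorData where
  /-- The roots `α` of the numerator terms `1 - α p^{-s}`. -/
  num : Multiset ℂ
  /-- The roots `β` of the denominator terms `(1 - β p^{-s})⁻¹`. -/
  den : Multiset ℂ

namespace EulerFactorData

/-- The numerator `∏_{α ∈ num} (1 - α p^{-s})` of the local factor at `p`.
[cite: DeligneSerreASENS1974, Lemma 4.9] -/
def numFun (D : EulerFactorData) (p : ℕ) (s : ℂ) : ℂ :=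
  (D.num.map fun α => eulerTerm p α s).prod

/-- The denominator `∏_{β ∈ den} (1 - β p^{-s})` of the local factor at `p`.
[cite: DeligneSerreASENS1974, Lemma 4.9] -/
def denFun (D : EulerFactorData) (p : ℕ) (s : ℂ) : ℂ :=
  (D.den.map fun α => eulerTerm p α s).prod

variable (D : EulerFactorData) (p : ℕ)

/-- The numerator vanishes iff one of its Euler terms does. [folklore] -/
theorem numFun_eq_zero_iff (s : ℂ) : D.numFun p s = 0 ↔ ∃ α ∈ D.num, eulerTerm p α s = 0 := by
  rw [numFun, Multiset.prod_eq_zero_iff, Multiset.mem_map]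

/-- The denominator vanishes iff one of its Euler terms does. [folklore] -/
theorem denFun_eq_zero_iff (s : ℂ) : D.denFun p s = 0 ↔ ∃ α ∈ D.den, eulerTerm p α s = 0 := by
  rw [denFun, Multiset.prod_eq_zero_iff, Multiset.mem_map]

/-- The numerator is continuous (`p ≠ 0`). [folklore] -/
theorem continuous_numFun (hp : p ≠ 0) : Continuous (D.numFun p) :=
  continuous_multiset_prod _ fun α _ => continuous_eulerTerm hp α

/-- The denominator is continuous (`p ≠ 0`). [folklore] -/
theorem continuous_denFun (hp : p ≠ 0) : Continuous (D.denFun p) :=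
  continuous_multiset_prod _ fun α _ => continuous_eulerTerm hp α

/-- If all roots vanish the numerator is `1`. [folklore] -/
theorem numFun_eq_one_of_forall_eq_zero (h : ∀ α ∈ D.num, α = 0) (s : ℂ) : D.numFun p s = 1 := by
  rw [numFun, Multiset.prod_eq_one]
  intro x hx
  obtain ⟨α, hα, rfl⟩ := Multiset.mem_map.mp hx
  rw [h α hα, eulerTerm_zero]

/-- If all roots vanish the denominator is `1`. [folklore] -/
theorem denFun_eq_one_of_forall_eq_zero (h : ∀ α ∈ D.den, α = 0) (s : ℂ) : D.denFun p s = 1 := by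
  rw [denFun, Multiset.prod_eq_one]
  intro x hx
  obtain ⟨α, hα, rfl⟩ := Multiset.mem_map.mp hx
  rw [h α hα, eulerTerm_zero]

open scoped Classical in
/-- The **reduced** datum: common roots of numerator and denominator cancelled (multiset
differences `num - den`, `den - num`). [folklore] -/
def reduce (D : EulerFactorData) : EulerFactorData :=
  ⟨D.num - D.den, D.den - D.num⟩

open scoped Classical in
/-- The common part `num ∩ den` (multiset intersection, with multiplicity). [folklore] -/
def common (D : EulerFactorData) : Multiset ℂ :=
  D.num ∩ D.den

/-- The product of the Euler terms over the common part. [folklore] -/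
def commonFun (D : EulerFactorData) (p : ℕ) (s : ℂ) : ℂ :=
  (D.common.map fun α => eulerTerm p α s).prod

/-- `num = (num - den) + num ∩ den`. [folklore] -/
theorem reduce_num_add_common : D.reduce.num + D.common = D.num := by
  classical
  exact Multiset.sub_add_inter D.num D.den

/-- `den = (den - num) + num ∩ den`. [folklore] -/
theorem reduce_den_add_common : D.reduce.den + D.common = D.den := by
  classical
  rw [common, Multiset.inter_comm]
  exact Multiset.sub_add_inter D.den D.num

/-- `numFun = numFun ∘ reduce · commonFun`. [folklore] -/
theorem numFun_eq_reduce_mul_commonFun (s : ℂ) :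
    D.numFun p s = D.reduce.numFun p s * D.commonFun p s := by
  rw [numFun, numFun, commonFun, ← Multiset.prod_add, ← Multiset.map_add, reduce_num_add_common]

/-- `denFun = denFun ∘ reduce · commonFun`. [folklore] -/
theorem denFun_eq_reduce_mul_commonFun (s : ℂ) :
    D.denFun p s = D.reduce.denFun p s * D.commonFun p s := by
  rw [denFun, denFun, commonFun, ← Multiset.prod_add, ← Multiset.map_add, reduce_den_add_common]

/-- After reduction no root is common to numerator and denominator. [folklore] -/
theorem not_mem_reduce_den_of_mem_reduce_num {α : ℂ} (h : α ∈ D.reduce.num) :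
    α ∉ D.reduce.den := by
  classical
  intro h'
  change α ∈ D.num - D.den at h
  change α ∈ D.den - D.num at h'
  rw [← Multiset.count_pos, Multiset.count_sub] at h h'
  omega

/-- The roots of the reduced numerator are roots of the numerator. [folklore] -/
theorem mem_num_of_mem_reduce_num {α : ℂ} (h : α ∈ D.reduce.num) : α ∈ D.num := by
  classical
  exact Multiset.mem_of_le (Multiset.sub_le_self _ _) h

/-- The roots of the reduced denominator are roots of the denominator. [folklore] -/
theorem mem_den_of_mem_reduce_den {α : ℂ} (h : α ∈ D.reduce.den) : α ∈ D.den := by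
  classical
  exact Multiset.mem_of_le (Multiset.sub_le_self _ _) h

/-- The common roots are roots of the numerator. [folklore] -/
theorem mem_num_of_mem_common {α : ℂ} (h : α ∈ D.common) : α ∈ D.num := by
  classical
  exact Multiset.mem_of_le Multiset.inter_le_left h

/-- The common product vanishes iff one of its Euler terms does. [folklore] -/
theorem commonFun_eq_zero_iff (s : ℂ) :
    D.commonFun p s = 0 ↔ ∃ α ∈ D.common, eulerTerm p α s = 0 := by
  rw [commonFun, Multiset.prod_eq_zero_iff, Multiset.mem_map]

end EulerFactorData

/-- The numerator `∏_{p ∈ S} ∏_{α ∈ num_p} (1 - α p^{-s})` of the finite Euler product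
`∏_{p ∈ S} G_p(s)` with local data `G`. [cite: DeligneSerreASENS1974, Lemma 4.9] -/
def finiteEulerNum (S : Finset ℕ) (G : ℕ → EulerFactorData) (s : ℂ) : ℂ :=
  ∏ p ∈ S, (G p).numFun p s

/-- The denominator `∏_{p ∈ S} ∏_{β ∈ den_p} (1 - β p^{-s})` of the finite Euler product
`∏_{p ∈ S} G_p(s)` with local data `G`. [cite: DeligneSerreASENS1974, Lemma 4.9] -/
def finiteEulerDen (S : Finset ℕ) (G : ℕ → EulerFactorData) (s : ℂ) : ℂ :=
  ∏ p ∈ S, (G p).denFun p s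

section FiniteEuler

variable (S : Finset ℕ) (G : ℕ → EulerFactorData)

/-- The numerator of a finite Euler product vanishes iff some local numerator does. [folklore] -/
theorem finiteEulerNum_eq_zero_iff (s : ℂ) :
    finiteEulerNum S G s = 0 ↔ ∃ p ∈ S, ∃ α ∈ (G p).num, eulerTerm p α s = 0 := by
  rw [finiteEulerNum, Finset.prod_eq_zero_iff]
  simp only [EulerFactorData.numFun_eq_zero_iff]

/-- The denominator of a finite Euler product vanishes iff some local denominator does. [folklore] -/
theorem finiteEulerDen_eq_zero_iff (s : ℂ) :
    finiteEulerDen S G s = 0 ↔ ∃ p ∈ S, ∃ α ∈ (G p).den, eulerTerm p α s = 0 := by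
  rw [finiteEulerDen, Finset.prod_eq_zero_iff]
  simp only [EulerFactorData.denFun_eq_zero_iff]

/-- Continuity of the numerator (`0 ∉ S`). [folklore] -/
theorem continuous_finiteEulerNum (hS : ∀ p ∈ S, p ≠ 0) : Continuous (finiteEulerNum S G) :=
  continuous_finsetProd _ fun p hp => (G p).continuous_numFun p (hS p hp)

/-- Continuity of the denominator (`0 ∉ S`). [folklore] -/
theorem continuous_finiteEulerDen (hS : ∀ p ∈ S, p ≠ 0) : Continuous (finiteEulerDen S G) :=
  continuous_finsetProd _ fun p hp => (G p).continuous_denFun p (hS p hp)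

/-- The product of the common parts over `S`. [folklore] -/
def finiteEulerCommon (s : ℂ) : ℂ :=
  ∏ p ∈ S, (G p).commonFun p s

/-- `finiteEulerNum G = finiteEulerNum (reduce ∘ G) · finiteEulerCommon G`. [folklore] -/
theorem finiteEulerNum_eq_reduce_mul (s : ℂ) :
    finiteEulerNum S G s = finiteEulerNum S (fun p => (G p).reduce) s * finiteEulerCommon S G s := by
  rw [finiteEulerNum, finiteEulerNum, finiteEulerCommon, ← Finset.prod_mul_distrib]
  exact Finset.prod_congr rfl fun p _ => (G p).numFun_eq_reduce_mul_commonFun p s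

/-- `finiteEulerDen G = finiteEulerDen (reduce ∘ G) · finiteEulerCommon G`. [folklore] -/
theorem finiteEulerDen_eq_reduce_mul (s : ℂ) :
    finiteEulerDen S G s = finiteEulerDen S (fun p => (G p).reduce) s * finiteEulerCommon S G s := by
  rw [finiteEulerDen, finiteEulerDen, finiteEulerCommon, ← Finset.prod_mul_distrib]
  exact Finset.prod_congr rfl fun p _ => (G p).denFun_eq_reduce_mul_commonFun p s

/-- The zero set of the common product is countable (all `p ∈ S` prime). [folklore] -/
theorem countable_setOf_finiteEulerCommon_eq_zero (hS : ∀ p ∈ S, p.Prime) :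
    {s | finiteEulerCommon S G s = 0}.Countable := by
  classical
  have hsub : {s | finiteEulerCommon S G s = 0} ⊆
      ⋃ p ∈ (S : Set ℕ), ⋃ α ∈ ((G p).common.toFinset : Set ℂ), {s | eulerTerm p α s = 0} := by
    intro s hs
    obtain ⟨p, hp, hp0⟩ := Finset.prod_eq_zero_iff.mp hs
    obtain ⟨α, hα, hα0⟩ := ((G p).commonFun_eq_zero_iff p s).mp hp0
    exact Set.mem_biUnion (Finset.mem_coe.mpr hp)
      (Set.mem_biUnion (Finset.mem_coe.mpr (Multiset.mem_toFinset.mpr hα)) hα0)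
  refine Set.Countable.mono hsub (Set.Countable.biUnion (Finset.countable_toSet _) fun p hp => ?_)
  exact Set.Countable.biUnion (Finset.countable_toSet _) fun α _ =>
    countable_setOf_eulerTerm_eq_zero (hS p hp).one_lt α

end FiniteEuler

/-! ### Deligne–Serre 1974, Lemma 4.9 -/

namespace ModularForms.DeligneSerre1974

/-- **Deligne–Serre 1974, Lemma 4.9** (rigidity of finite Euler products with a functional
equation).  Let `G(s) = A^s ∏_p G_p(s)` and `H(s) = A^s ∏_p H_p(s)` be two *finite* Euler
products (`A > 0`; `p` over a finite set `S` of primes), each `G_p` and each `H_p` a finite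
product of terms `(1 - α p^{-s})^{±1}` with `|α| < p^{1/2}` (4.9.2), and suppose
`G(1 - s) = ω H(s)` with `ω ∈ ℂ*` (4.9.1).  Then `A = 1` and `G_p = H_p = 1` for every `p`.
Formalisation: the local factors are given by `EulerFactorData` (numerator roots `num_p`,
denominator roots `den_p`), `G(s) = A^s N_G(s)/D_G(s)` with `N_G = finiteEulerNum S G`,
`D_G = finiteEulerDen S G`; the identity (4.9.1) of meromorphic functions is stated in the
equivalent cross-multiplied form `A^{1-s} N_G(1-s) D_H(s) = ω A^s N_H(s) D_G(1-s)` for all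
`s` (both sides are entire, so equality off the poles is equality everywhere), and the
conclusion `G_p = 1` (resp. `H_p = 1`) as the identity of entire functions
`N_{G,p} = D_{G,p}` (resp. `N_{H,p} = D_{H,p}`).  Proof (op. cit. p. 516): if `H_p ≠ 1`, `H`
has infinitely many zeros or poles `(log α + 2πin)/log p`, `re < 1/2`, which cannot all be
zeros or poles of `G(1 - s)` (`re > 1/2`) — see `lemma49_holds`.
[cite: DeligneSerreASENS1974, Lemma 4.9] -/
def lemma49 : Prop :=
  ∀ (S : Finset ℕ) (_hS : ∀ p ∈ S, p.Prime) (A : ℝ) (_hA : 0 < A) (G H : ℕ → EulerFactorData)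
    (_hG : ∀ p ∈ S, ∀ α ∈ (G p).num + (G p).den, ‖α‖ < Real.sqrt p)
    (_hH : ∀ p ∈ S, ∀ α ∈ (H p).num + (H p).den, ‖α‖ < Real.sqrt p) (ω : ℂ) (_hω : ω ≠ 0)
    (_hFE : ∀ s : ℂ,
      (A : ℂ) ^ (1 - s) * finiteEulerNum S G (1 - s) * finiteEulerDen S H s =
        ω * (A : ℂ) ^ s * finiteEulerNum S H s * finiteEulerDen S G (1 - s)),
    A = 1 ∧ ∀ p ∈ S, (∀ s, (G p).numFun p s = (G p).denFun p s) ∧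
      (∀ s, (H p).numFun p s = (H p).denFun p s)

/-! #### Proof -/

/-- **Key step.**  Let `p ∈ S` be prime, `α ≠ 0`, and `M_q` (`q ∈ S`) finite families of roots
with `α ∉ M_p`.  It is impossible that every zero of `1 - α p^{-s}` be a zero of some
`1 - β q^{-s}`, `q ∈ S`, `β ∈ M_q`: for `q = p` a common zero forces `β = α ∈ M_p`, and for
`q ≠ p` each pair of terms has at most one common zero
(`subsingleton_setOf_eulerTerm_eq_zero_and`), while `1 - α p^{-s}` has infinitely many zeros.
Ref: Deligne–Serre 1974, proof of Lemma 4.9. [cite: DeligneSerreASENS1974, Lemma 4.9] -/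
theorem lemma49_key {S : Finset ℕ} (hS : ∀ q ∈ S, q.Prime) {p : ℕ} (hp : p ∈ S) {α : ℂ}
    (hα : α ≠ 0) (M : ℕ → Multiset ℂ) (hαM : α ∉ M p)
    (hcover : ∀ s, eulerTerm p α s = 0 → ∃ q ∈ S, ∃ β ∈ M q, eulerTerm q β s = 0) : False := by
  classical
  have hpp := hS p hp
  set F : Set ℂ := ⋃ q ∈ ((S.erase p : Finset ℕ) : Set ℕ), ⋃ β ∈ ((M q).toFinset : Set ℂ),
      {s | eulerTerm p α s = 0 ∧ eulerTerm q β s = 0} with hF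
  have hFfin : F.Finite := by
    refine Set.Finite.biUnion (Finset.finite_toSet _) fun q hq => ?_
    obtain ⟨hqp, hqS⟩ := Finset.mem_erase.mp (Finset.mem_coe.mp hq)
    exact Set.Finite.biUnion (Finset.finite_toSet _) fun β _ =>
      (subsingleton_setOf_eulerTerm_eq_zero_and hpp (hS q hqS) (Ne.symm hqp) α β).finite
  have hsub : {s | eulerTerm p α s = 0} ⊆ F := by
    intro s hs
    obtain ⟨q, hqS, β, hβ, hq0⟩ := hcover s hs
    have hqp : q ≠ p := by
      rintro rfl
      exact hαM ((eq_of_eulerTerm_eq_zero hs hq0) ▸ hβ)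
    rw [hF]
    exact Set.mem_biUnion (Finset.mem_coe.mpr (Finset.mem_erase.mpr ⟨hqp, hqS⟩))
      (Set.mem_biUnion (Finset.mem_coe.mpr (Multiset.mem_toFinset.mpr hβ)) ⟨hs, hq0⟩)
  exact infinite_setOf_eulerTerm_eq_zero hpp.one_lt hα (hFfin.subset hsub)

/-- Zeros of a numerator or denominator evaluated at `1 - s` have `re s > 1/2` under the bound
`|α| < p^{1/2}`; contrapositive form used below: if `re s < 1/2` the value at `1 - s` is
nonzero. [cite: DeligneSerreASENS1974, Lemma 4.9] -/
theorem finiteEulerNum_one_sub_ne_zero {S : Finset ℕ} (hS : ∀ p ∈ S, p.Prime)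
    {G : ℕ → EulerFactorData} (hG : ∀ p ∈ S, ∀ α ∈ (G p).num, ‖α‖ < Real.sqrt p) {s : ℂ}
    (hs : s.re < 1 / 2) : finiteEulerNum S G (1 - s) ≠ 0 := by
  intro h0
  obtain ⟨p, hp, α, hα, h⟩ := (finiteEulerNum_eq_zero_iff S G (1 - s)).mp h0
  have := re_lt_of_eulerTerm_eq_zero (hS p hp).one_lt (hG p hp α hα) h
  rw [sub_re, one_re] at this
  linarith

/-- Denominator version of `finiteEulerNum_one_sub_ne_zero`. [cite: DeligneSerreASENS1974, Lemma 4.9] -/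
theorem finiteEulerDen_one_sub_ne_zero {S : Finset ℕ} (hS : ∀ p ∈ S, p.Prime)
    {G : ℕ → EulerFactorData} (hG : ∀ p ∈ S, ∀ α ∈ (G p).den, ‖α‖ < Real.sqrt p) {s : ℂ}
    (hs : s.re < 1 / 2) : finiteEulerDen S G (1 - s) ≠ 0 := by
  intro h0
  obtain ⟨p, hp, α, hα, h⟩ := (finiteEulerDen_eq_zero_iff S G (1 - s)).mp h0
  have := re_lt_of_eulerTerm_eq_zero (hS p hp).one_lt (hG p hp α hα) h
  rw [sub_re, one_re] at this
  linarith

/-- **Core of Lemma 4.9** (one side, reduced data).  Under the cross-multiplied functional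
equation, if no root is common to `num_p(H)` and `den_p(H)`, then all roots of `H` at every
`p ∈ S` vanish, i.e. `H_p = 1`.  Ref: Deligne–Serre 1974, proof of Lemma 4.9.
[cite: DeligneSerreASENS1974, Lemma 4.9] -/
theorem lemma49_core {S : Finset ℕ} (hS : ∀ p ∈ S, p.Prime) {A : ℝ} (hA : 0 < A)
    {G H : ℕ → EulerFactorData}
    (hGn : ∀ p ∈ S, ∀ α ∈ (G p).num, ‖α‖ < Real.sqrt p)
    (hGd : ∀ p ∈ S, ∀ α ∈ (G p).den, ‖α‖ < Real.sqrt p)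
    (hHn : ∀ p ∈ S, ∀ α ∈ (H p).num, ‖α‖ < Real.sqrt p)
    (hHd : ∀ p ∈ S, ∀ α ∈ (H p).den, ‖α‖ < Real.sqrt p)
    (hdisj : ∀ p ∈ S, ∀ α ∈ (H p).num, α ∉ (H p).den) {ω : ℂ} (hω : ω ≠ 0)
    (hFE : ∀ s : ℂ,
      (A : ℂ) ^ (1 - s) * finiteEulerNum S G (1 - s) * finiteEulerDen S H s =
        ω * (A : ℂ) ^ s * finiteEulerNum S H s * finiteEulerDen S G (1 - s)) :
    ∀ p ∈ S, (∀ α ∈ (H p).num, α = 0) ∧ (∀ α ∈ (H p).den, α = 0) := by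
  have hA0 : (A : ℂ) ≠ 0 := ofReal_ne_zero.mpr hA.ne'
  have hAs : ∀ s : ℂ, (A : ℂ) ^ s ≠ 0 := fun s => cpow_ne_zero_iff.mpr (Or.inl hA0)
  intro p hp
  constructor
  · intro α hα
    by_contra hα0
    refine lemma49_key hS hp hα0 (fun q => (H q).den) (hdisj p hp α hα) fun s hs => ?_
    have hre : s.re < 1 / 2 := re_lt_of_eulerTerm_eq_zero (hS p hp).one_lt (hHn p hp α hα) hs
    have hN : finiteEulerNum S H s = 0 :=
      (finiteEulerNum_eq_zero_iff S H s).mpr ⟨p, hp, α, hα, hs⟩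
    have h := hFE s
    rw [hN, mul_zero, zero_mul, mul_eq_zero, mul_eq_zero, or_iff_right (hAs _),
      or_iff_right (finiteEulerNum_one_sub_ne_zero hS hGn hre)] at h
    exact (finiteEulerDen_eq_zero_iff S H s).mp h
  · intro β hβ
    by_contra hβ0
    refine lemma49_key hS hp hβ0 (fun q => (H q).num) (fun h => hdisj p hp β h hβ) fun s hs => ?_
    have hre : s.re < 1 / 2 := re_lt_of_eulerTerm_eq_zero (hS p hp).one_lt (hHd p hp β hβ) hs
    have hD : finiteEulerDen S H s = 0 :=
      (finiteEulerDen_eq_zero_iff S H s).mpr ⟨p, hp, β, hβ, hs⟩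
    have h := (hFE s).symm
    rw [hD, mul_zero, mul_eq_zero, mul_eq_zero, mul_eq_zero, or_iff_right hω,
      or_iff_right (hAs _), or_iff_left (finiteEulerDen_one_sub_ne_zero hS hGd hre)] at h
    exact (finiteEulerNum_eq_zero_iff S H s).mp h

/-- The cross-multiplied functional equation is symmetric under
`(G, H, ω) ↦ (H, G, ω⁻¹)` (substitute `s ↦ 1 - s`). [cite: DeligneSerreASENS1974, Lemma 4.9] -/
theorem lemma49_symm {S : Finset ℕ} {A : ℝ} {G H : ℕ → EulerFactorData} {ω : ℂ} (hω : ω ≠ 0)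
    (hFE : ∀ s : ℂ,
      (A : ℂ) ^ (1 - s) * finiteEulerNum S G (1 - s) * finiteEulerDen S H s =
        ω * (A : ℂ) ^ s * finiteEulerNum S H s * finiteEulerDen S G (1 - s)) (s : ℂ) :
    (A : ℂ) ^ (1 - s) * finiteEulerNum S H (1 - s) * finiteEulerDen S G s =
      ω⁻¹ * (A : ℂ) ^ s * finiteEulerNum S G s * finiteEulerDen S H (1 - s) := by
  have h := hFE (1 - s)
  rw [sub_sub_cancel] at h
  calc (A : ℂ) ^ (1 - s) * finiteEulerNum S H (1 - s) * finiteEulerDen S G s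
        = ω⁻¹ * (ω * (A : ℂ) ^ (1 - s) * finiteEulerNum S H (1 - s) * finiteEulerDen S G s) := by
          field_simp
    _ = ω⁻¹ * ((A : ℂ) ^ s * finiteEulerNum S G s * finiteEulerDen S H (1 - s)) := by rw [← h]
    _ = _ := by ring

/-- **Reduction step.**  The cross-multiplied functional equation for `(G, H)` implies the one
for the reduced data (common roots of `num_p` and `den_p` cancelled): both differ by the
factor `C_G(1 - s) C_H(s)` (products of the common Euler terms), which is nonzero off a
countable set; the two sides being continuous and the complement of a countable subset of
`ℂ` dense, the reduced identity holds everywhere. [folklore] -/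
theorem lemma49_reduce {S : Finset ℕ} (hS : ∀ p ∈ S, p.Prime) {A : ℝ} (hA : 0 < A)
    {G H : ℕ → EulerFactorData} {ω : ℂ}
    (hFE : ∀ s : ℂ,
      (A : ℂ) ^ (1 - s) * finiteEulerNum S G (1 - s) * finiteEulerDen S H s =
        ω * (A : ℂ) ^ s * finiteEulerNum S H s * finiteEulerDen S G (1 - s)) (s : ℂ) :
    (A : ℂ) ^ (1 - s) * finiteEulerNum S (fun p => (G p).reduce) (1 - s) *
        finiteEulerDen S (fun p => (H p).reduce) s =
      ω * (A : ℂ) ^ s * finiteEulerNum S (fun p => (H p).reduce) s *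
        finiteEulerDen S (fun p => (G p).reduce) (1 - s) := by
  have hS0 : ∀ p ∈ S, p ≠ 0 := fun p hp => (hS p hp).ne_zero
  have hA0 : (A : ℂ) ≠ 0 := ofReal_ne_zero.mpr hA.ne'
  have hsub : Continuous fun s : ℂ => 1 - s := continuous_const.sub continuous_id
  suffices heq : (fun s : ℂ => (A : ℂ) ^ (1 - s) * finiteEulerNum S (fun p => (G p).reduce) (1 - s) *
        finiteEulerDen S (fun p => (H p).reduce) s) =
      fun s : ℂ => ω * (A : ℂ) ^ s * finiteEulerNum S (fun p => (H p).reduce) s *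
        finiteEulerDen S (fun p => (G p).reduce) (1 - s) from congrFun heq s
  have hfc : Continuous fun s : ℂ => (A : ℂ) ^ (1 - s) *
      finiteEulerNum S (fun p => (G p).reduce) (1 - s) * finiteEulerDen S (fun p => (H p).reduce) s :=
    ((hsub.const_cpow (Or.inl hA0)).mul
      ((continuous_finiteEulerNum S _ hS0).comp hsub)).mul (continuous_finiteEulerDen S _ hS0)
  have hgc : Continuous fun s : ℂ => ω * (A : ℂ) ^ s *
      finiteEulerNum S (fun p => (H p).reduce) s * finiteEulerDen S (fun p => (G p).reduce) (1 - s) :=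
    ((continuous_const.mul (continuous_id.const_cpow (Or.inl hA0))).mul
      (continuous_finiteEulerNum S _ hS0)).mul ((continuous_finiteEulerDen S _ hS0).comp hsub)
  -- the exceptional set: zeros of the cancelled common factors
  have hE : ({s : ℂ | finiteEulerCommon S G (1 - s) = 0} ∪
      {s | finiteEulerCommon S H s = 0}).Countable := by
    refine Set.Countable.union ?_ (countable_setOf_finiteEulerCommon_eq_zero S H hS)
    have : {s : ℂ | finiteEulerCommon S G (1 - s) = 0} =
        (fun s => 1 - s) '' {s | finiteEulerCommon S G s = 0} := by
      ext s
      constructor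
      · intro hs
        exact ⟨1 - s, hs, sub_sub_cancel 1 s⟩
      · rintro ⟨t, ht, rfl⟩
        show finiteEulerCommon S G (1 - (1 - t)) = 0
        rwa [sub_sub_cancel]
    rw [this]
    exact (countable_setOf_finiteEulerCommon_eq_zero S G hS).image _
  refine Continuous.ext_on (hE.dense_compl ℝ) hfc hgc fun s hs => ?_
  rw [Set.mem_compl_iff, Set.mem_union, not_or] at hs
  have hs' : finiteEulerCommon S G (1 - s) * finiteEulerCommon S H s ≠ 0 := mul_ne_zero hs.1 hs.2
  have h := hFE s
  rw [finiteEulerNum_eq_reduce_mul S G, finiteEulerDen_eq_reduce_mul S H,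
    finiteEulerNum_eq_reduce_mul S H, finiteEulerDen_eq_reduce_mul S G] at h
  apply mul_right_cancel₀ hs'
  linear_combination h

/-- **Proof of Deligne–Serre 1974, Lemma 4.9.**  Reduce to data without common roots
(`lemma49_reduce`); apply the core step to `(G, H, ω)` and, after the substitution
`s ↦ 1 - s` (`lemma49_symm`), to `(H, G, ω⁻¹)`: all roots of the reduced data vanish, so
`N_{G,p} = C_p = D_{G,p}` and likewise for `H`; finally the identity collapses to
`A^{1-s} = ω A^s`, whence `ω = 1` (`s = 1/2`) and `A = 1` (`s = 0`).
Ref: Deligne–Serre, *Formes modulaires de poids 1*, Ann. Sci. ÉNS 7 (1974), Lemma 4.9,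
p. 516. [cite: DeligneSerreASENS1974, Lemma 4.9] -/
theorem lemma49_holds : lemma49 := by
  intro S hS A hA G H hG hH ω hω hFE
  have hA0 : (A : ℂ) ≠ 0 := ofReal_ne_zero.mpr hA.ne'
  -- bounds, split into numerator and denominator roots
  have hGn : ∀ p ∈ S, ∀ α ∈ (G p).num, ‖α‖ < Real.sqrt p :=
    fun p hp α hα => hG p hp α (Multiset.mem_add.mpr (Or.inl hα))
  have hGd : ∀ p ∈ S, ∀ α ∈ (G p).den, ‖α‖ < Real.sqrt p :=
    fun p hp α hα => hG p hp α (Multiset.mem_add.mpr (Or.inr hα))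
  have hHn : ∀ p ∈ S, ∀ α ∈ (H p).num, ‖α‖ < Real.sqrt p :=
    fun p hp α hα => hH p hp α (Multiset.mem_add.mpr (Or.inl hα))
  have hHd : ∀ p ∈ S, ∀ α ∈ (H p).den, ‖α‖ < Real.sqrt p :=
    fun p hp α hα => hH p hp α (Multiset.mem_add.mpr (Or.inr hα))
  -- reduced data
  set G' : ℕ → EulerFactorData := fun p => (G p).reduce with hG'
  set H' : ℕ → EulerFactorData := fun p => (H p).reduce with hH'
  have hG'n : ∀ p ∈ S, ∀ α ∈ (G' p).num, ‖α‖ < Real.sqrt p :=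
    fun p hp α hα => hGn p hp α ((G p).mem_num_of_mem_reduce_num hα)
  have hG'd : ∀ p ∈ S, ∀ α ∈ (G' p).den, ‖α‖ < Real.sqrt p :=
    fun p hp α hα => hGd p hp α ((G p).mem_den_of_mem_reduce_den hα)
  have hH'n : ∀ p ∈ S, ∀ α ∈ (H' p).num, ‖α‖ < Real.sqrt p :=
    fun p hp α hα => hHn p hp α ((H p).mem_num_of_mem_reduce_num hα)
  have hH'd : ∀ p ∈ S, ∀ α ∈ (H' p).den, ‖α‖ < Real.sqrt p :=
    fun p hp α hα => hHd p hp α ((H p).mem_den_of_mem_reduce_den hα)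
  have hdisjG : ∀ p ∈ S, ∀ α ∈ (G' p).num, α ∉ (G' p).den :=
    fun p _ α hα => (G p).not_mem_reduce_den_of_mem_reduce_num hα
  have hdisjH : ∀ p ∈ S, ∀ α ∈ (H' p).num, α ∉ (H' p).den :=
    fun p _ α hα => (H p).not_mem_reduce_den_of_mem_reduce_num hα
  have hFE' : ∀ s : ℂ, (A : ℂ) ^ (1 - s) * finiteEulerNum S G' (1 - s) * finiteEulerDen S H' s =
      ω * (A : ℂ) ^ s * finiteEulerNum S H' s * finiteEulerDen S G' (1 - s) :=
    lemma49_reduce hS hA hFE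
  -- core step, twice
  have hHzero := lemma49_core hS hA hG'n hG'd hH'n hH'd hdisjH hω hFE'
  have hGzero := lemma49_core hS hA hH'n hH'd hG'n hG'd hdisjG (inv_ne_zero hω)
    (lemma49_symm hω hFE')
  -- local conclusions
  have hGp : ∀ p ∈ S, ∀ s, (G p).numFun p s = (G p).denFun p s := fun p hp s => by
    rw [(G p).numFun_eq_reduce_mul_commonFun, (G p).denFun_eq_reduce_mul_commonFun,
      (G p).reduce.numFun_eq_one_of_forall_eq_zero p (hGzero p hp).1,
      (G p).reduce.denFun_eq_one_of_forall_eq_zero p (hGzero p hp).2]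
  have hHp : ∀ p ∈ S, ∀ s, (H p).numFun p s = (H p).denFun p s := fun p hp s => by
    rw [(H p).numFun_eq_reduce_mul_commonFun, (H p).denFun_eq_reduce_mul_commonFun,
      (H p).reduce.numFun_eq_one_of_forall_eq_zero p (hHzero p hp).1,
      (H p).reduce.denFun_eq_one_of_forall_eq_zero p (hHzero p hp).2]
  refine ⟨?_, fun p hp => ⟨hGp p hp, hHp p hp⟩⟩
  -- `A = 1`
  have hNG : ∀ s, finiteEulerNum S G' s = 1 := fun s =>
    Finset.prod_eq_one fun p hp => (G p).reduce.numFun_eq_one_of_forall_eq_zero p (hGzero p hp).1 s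
  have hDG : ∀ s, finiteEulerDen S G' s = 1 := fun s =>
    Finset.prod_eq_one fun p hp => (G p).reduce.denFun_eq_one_of_forall_eq_zero p (hGzero p hp).2 s
  have hNH : ∀ s, finiteEulerNum S H' s = 1 := fun s =>
    Finset.prod_eq_one fun p hp => (H p).reduce.numFun_eq_one_of_forall_eq_zero p (hHzero p hp).1 s
  have hDH : ∀ s, finiteEulerDen S H' s = 1 := fun s =>
    Finset.prod_eq_one fun p hp => (H p).reduce.denFun_eq_one_of_forall_eq_zero p (hHzero p hp).2 s
  have key : ∀ s : ℂ, (A : ℂ) ^ (1 - s) = ω * (A : ℂ) ^ s := fun s => by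
    have := hFE' s
    rwa [hNG, hDH, hNH, hDG, mul_one, mul_one, mul_one, mul_one] at this
  have hω1 : ω = 1 := by
    have h := key (1 / 2)
    rw [show (1 : ℂ) - 1 / 2 = 1 / 2 by norm_num] at h
    exact (mul_eq_right₀ (cpow_ne_zero_iff.mpr (Or.inl hA0))).mp h.symm
  have h := key 0
  rw [sub_zero, cpow_one, cpow_zero, hω1, one_mul] at h
  exact_mod_cast h

end ModularForms.DeligneSerre1974

end Literature.NumberTheory.LFunctions
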